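import Mathlib
import HarnessLib
import Summits.HubbardSuperconductivity.HubbardSuperconductivity.Theorems.KLProgrammeKLRegimeEngineV8E5Block
import Summits.HubbardSuperconductivity.HubbardSuperconductivity.Theorems.KLProgrammeKLRegimeEngineV8E5PointAugment
import Summits.HubbardSuperconductivity.HubbardSuperconductivity.Theorems.KLProgrammeKLRegimeEngineV8E5Lines
import Summits.HubbardSuperconductivity.HubbardSuperconductivity.Theorems.KLProgrammeKLRegimeEngineNormsStepDoor
import Summits.HubbardSuperconductivity.HubbardSuperconductivity.Theorems.KLProgrammeKLRegimeWickScaleFlowLines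
import Summits.HubbardSuperconductivity.HubbardSuperconductivity.Theorems.KLProgrammeKLRegimeFatOverlapCount

/-!
# Route `KLProgramme` — ENGINE child gen 8 (stmt-HubbardSuperconductivity-20437 `KLRegimeEngineV17F2`), SKELETON v2 class #3, PROVING side:
# the E.5 block at EVERY pair label of the UV ball — `…E5Block` through the point-augmented pair (FINDING (E5-LABELS), cure (α))
# (cell gate-hubbard-kl, seat p5 g7; composes `…EngineV8E5Block` (p544244) with `…EngineV8E5PointAugment`)

* §1 `klE5ExtMomenta Qm x y = ![(y.2,y.1), (y.2.rev,Qm−y.1), (x.2.rev,Qm−x.1), (x.2,x.1)]` (the momenta of `klE5Block`'s label tuple) and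
  **`norm_klE5Block_le_of_tails_pointAugment`** — `norm_klE5Block_le_of_tails` at ANY labels `x y` (NO plateau hypothesis on them; the plateau of `F` is
  only required on the legs of the two lines): the pair is augmented at `klE5ExtMomenta Qm x y`, the tails `T s` are those of the preimage under the augmented
  THIN family with lines pulled back by the augmented FAT family; `sum_norm_sectorSubMatrix_pointAugmentFat_le` gives its `R₁` with multiplicity `ρ₁ + 4`;
* §2 **`klE5_tail_le_of_lineData_pointAugment(_of_b)`** — hypothesis `hT` of §1 at a colouring from the OLD line data (`α`, `δ`, `κ` w.r.t. `F̃`, symbols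
  supported in the old plateau, overlap `ρ₀ + ρ₁ + 4`) and the carrier's MIXED level norms w.r.t. `pointAugment F (klE5ExtMomenta Qm x y)` — the ONE new
  datum the `∃ (C,u), E5ShareStep P R C u` witness asks of the tower / class #5 (all-point prescription = the value currency of (E5-F); all-thin = class #1
  `LevelsUAt`; point legs count as PRESCRIBED in `levelCount`).

* §3 the PLATEAU hypotheses for `F = klAnisoFamily … klE0 m`, `m + 1 ≤ n₀`, `0 < Λ ≤ Λ_{n₀}` (so for the step `n−1 → n`: `m ≤ n−2`): supports of the two
  line symbols from the cutoff geometry (`sq_le_sq_of_klE5DerivLineSym_ne_zero`, `sq_lt_sq_of_klE5SoftLineSym_ne_zero`), hence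
  `klE5DressedSliceDeriv_plateau_klAnisoFamily` (hĊ), `klE5Total_sub_dressedSlice_plateau_klAnisoFamily` (hD), `klE5_sym_plateau_klAnisoFamily` (hsym for
  the two-symbol family `![klE5DerivLineSym, klE5SoftLineSym]`) — via k3c2-p3's `sum_klAnisoFamily_eq_one_of_le` and (G2)'s support reductions.

* §4 sup sizes of the two symbols under the dressing smallness `‖sκ‖ ≤ ½` (`norm_klE5DerivLineSym_le`: `≤ 4‖ṡ_Λ‖`; `norm_klE5SoftLineSym_le`:
  `≤ 4‖(1−w_{Λ_{n₀+1}})βL²G‖ + 2‖s_{Λ_{n₀+1}}‖ + 2‖s_Λ‖`) — so sup-type line data of the DRESSED lines follow from the bare symbols'.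

* §5 **`norm_klE5Block_le_of_tails_klAniso`** — the INSTANCE OF RECORD: `F = klAnisoFamily … K klE0 (m+1)`, `F̃ = bgmFatMultiplier … (m+1)`, `m + 2 ≤ n₀`,
  `0 < Λ ≤ Λ_{n₀}`: every family-side hypothesis discharged (`bgmFatMultiplier_mul_bgmMultiplier`, `klAnisoFamily_eq_zero_of_sum_eq_zero`, §3,
  `norm_bgmFatMultiplier_le_one`, `card_overlap_bgmFat_le_nine` ⇒ multiplicity `9`, `R₁ = ((βL²)⁻¹·|SpaceTimeIdx|)·13`); only `hT` remains.

Pure composition; one def with body (`klE5ExtMomenta`); no named facts; nothing about sizes is asserted; nothing asserts superconductivity. -/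

noncomputable section

namespace Summit.HubbardSuperconductivity.HubbardSuperconductivity.Theorems.KLRegimeSplit

set_option linter.dupNamespace false -- summit = problem name (single-conjunct summit), D-0017

open Real Finset Literature.MathematicalPhysics.QuantumLattice Literature.Probability.LatticeModels GrassmannAlgebra Matrix
open Summit.HubbardSuperconductivity.HubbardSuperconductivity.Theorems.KLProgrammeLegKernels
open Summit.HubbardSuperconductivity.HubbardSuperconductivity.Theorems.EngineV8
open Summit.HubbardSuperconductivity.HubbardSuperconductivity.Theorems.KLRegimeWick
open Summit.HubbardSuperconductivity.HubbardSuperconductivity.Theorems.TwoPointAssembly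
open Summit.HubbardSuperconductivity.HubbardSuperconductivity.Theorems.TorusFourierL2

/-! ## §1 The E.5 block at EVERY pair label: `…E5Block` §2 through the augmented pair -/

section Block

variable {L M N : ℕ} [NeZero L] [NeZero M] (β μ : ℝ) (K : TrigPolyC4v) (n₀ : ℕ) (κ : FreqMomentum L M × Fin 2 → ℂ)
  (V : HubbardGrassmann L M) (Λ : ℝ) (Qm : TorusSite 2 L) (x y : TorusSite 2 L × MatsubaraIdx M)

/-- **The four external momenta of the block's label tuple** (in the order of `klE5Block`'s tuple). -/
def klE5ExtMomenta : Fin 4 → FreqMomentum L M := ![(y.2, y.1), (y.2.rev, Qm - y.1), (x.2.rev, Qm - x.1), (x.2, x.1)]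

/-- **The E.5 block bounded at ANY pair labels** (no plateau condition on the labels): `norm_klE5Block_le_of_tails` for the pair augmented by the
points at the four external momenta — plateau of `F` only required on the legs of the two lines; the tails `T s` are those of the preimage under the
augmented THIN family with lines pulled back by the augmented FAT family. [cite: BenfattoGiulianiMastropietro2006, §2.7 (2.70)] -/
theorem norm_klE5Block_le_of_tails_pointAugment (hβ : β ≠ 0) (F Ft : Fin N → FreqMomentum L M → ℂ)
    (hFF : ∀ ω k, Ft ω k * F ω k = F ω k) (hF0 : ∀ k, ∑ ω, F ω k = 0 → ∀ ω, F ω k = 0)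
    (hĊ : ∀ X Y, klE5DressedSliceDeriv L M β μ K n₀ κ Λ X Y ≠ 0 → ∑ ω, F ω X.1.1 = 1 ∧ ∑ ω, F ω Y.1.1 = 1)
    (hD : ∀ X Y, (klE5Total L M β μ K n₀ κ - klE5DressedSlice L M β μ K n₀ κ Λ) X Y ≠ 0 → ∑ ω, F ω X.1.1 = 1 ∧ ∑ ω, F ω Y.1.1 = 1)
    {R : ℝ} (hS : ∀ X, ∑ Y, ‖sectorSubMatrix L M β (pointAugmentFat F Ft (klE5ExtMomenta Qm x y)) X Y‖ ≤ R)
    (T : (Fin 4 → Fin 2) → ℝ) (hT0 : ∀ s, 0 ≤ T s)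
    (hT : ∀ (s : Fin 4 → Fin 2) (Z : Fin 4 → SpaceTimeIdx L M × SectorLeg (N + 4)),
      ∑ i ∈ Finset.Icc 2 (Fintype.card (HubbardFieldIdx L M × Fin 2) + 1), ((i.factorial : ℝ))⁻¹ *
        ‖kernel ℂ ((grassmannLaplacian ℂ (crossCov ℂ ((sectorSubMatrix L M β (pointAugmentFat F Ft (klE5ExtMomenta Qm x y))).transpose *
              (klE5Total L M β μ K n₀ κ - klE5DressedSlice L M β μ K n₀ κ Λ) * sectorSubMatrix L M β (pointAugmentFat F Ft (klE5ExtMomenta Qm x y)))) ^ i *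
            grassmannLaplacian ℂ (crossCov ℂ ((sectorSubMatrix L M β (pointAugmentFat F Ft (klE5ExtMomenta Qm x y))).transpose *
              klE5DressedSliceDeriv L M β μ K n₀ κ Λ * sectorSubMatrix L M β (pointAugmentFat F Ft (klE5ExtMomenta Qm x y)))))
          (dblCopy ℂ 0 (sectorPreimage β (pointAugment F (klE5ExtMomenta Qm x y)) (klE5Carrier L M β μ K n₀ κ V Λ)) *
            dblCopy ℂ 1 (sectorPreimage β (pointAugment F (klE5ExtMomenta Qm x y)) (klE5Carrier L M β μ K n₀ κ V Λ)))) 4 (fun j => (Z j, s j))‖ ≤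
        T s) :
    ‖klE5Block L M β μ K n₀ κ V Λ Qm x y‖ ≤ ((4 : ℕ).factorial : ℝ) * |β * (L : ℝ) ^ 2| ^ 3 * (R ^ 4 * ∑ s : Fin 4 → Fin 2, T s) := by
  refine norm_klE5Block_le_of_tails β μ K n₀ κ V Λ Qm x y hβ (pointAugment F (klE5ExtMomenta Qm x y)) (pointAugmentFat F Ft (klE5ExtMomenta Qm x y))
    (pointAugmentFat_mul_pointAugment F Ft _ hFF) (pointAugment_eq_zero_of_sum_eq_zero F _ hF0)
    (fun X Y h => ⟨sum_pointAugment_eq_one_of_eq_one F _ (hĊ X Y h).1, sum_pointAugment_eq_one_of_eq_one F _ (hĊ X Y h).2⟩)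
    (fun X Y h => ⟨sum_pointAugment_eq_one_of_eq_one F _ (hD X Y h).1, sum_pointAugment_eq_one_of_eq_one F _ (hD X Y h).2⟩)
    (sum_pointAugment_eq_one_of_exists F _ ⟨3, rfl⟩) (sum_pointAugment_eq_one_of_exists F _ ⟨2, rfl⟩)
    (sum_pointAugment_eq_one_of_exists F _ ⟨0, rfl⟩) (sum_pointAugment_eq_one_of_exists F _ ⟨1, rfl⟩) hS T hT0 hT

omit [NeZero M] in
/-- **Row sums of the augmented substitution** from the old multiplicity: `Σ_Y ‖S(F̃⁺) K Y‖ ≤ ((βL²)⁻¹·|SpaceTimeIdx|)·(ρ₁ + 4)`. -/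
theorem sum_norm_sectorSubMatrix_pointAugmentFat_le (F Ft : Fin N → FreqMomentum L M → ℂ) (hFt : ∀ ω k, ‖Ft ω k‖ ≤ 1) {ρ₁ : ℕ}
    (hρ₁ : ∀ k : FreqMomentum L M, ((univ : Finset (Fin N)).filter fun ω => Ft ω k ≠ 0).card ≤ ρ₁) (X : HubbardFieldIdx L M) :
    ∑ Y, ‖sectorSubMatrix L M β (pointAugmentFat F Ft (klE5ExtMomenta Qm x y)) X Y‖ ≤
      (‖((1 / (β * (L : ℝ) ^ 2) : ℝ) : ℂ)‖ * Fintype.card (SpaceTimeIdx L M)) * ((ρ₁ + 4 : ℕ) : ℝ) :=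
  sum_norm_sectorSubMatrix_le β _ (norm_pointAugmentFat_le_one F Ft _ hFt) (card_filter_pointAugmentFat_ne_zero_le F Ft _ hρ₁) X

end Block

/-! ## §2 The tails of the augmented pair from the OLD line data + MIXED level norms (`…E5Block` §4 through `…E5PointAugment` §2) -/

section Tails

variable {L M N : ℕ} [NeZero L] (β μ : ℝ) (K : TrigPolyC4v) (n₀ : ℕ) (κ : FreqMomentum L M × Fin 2 → ℂ)
  (V : HubbardGrassmann L M) (Λ : ℝ) (Qm : TorusSite 2 L) (x y : TorusSite 2 L × MatsubaraIdx M) {ι : Type*} [Fintype ι] [DecidableEq ι]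

/-- **Hypothesis `hT` of `norm_klE5Block_le_of_tails_pointAugment` at a colouring with `m₀ + 1 ≥ 1` legs from copy `0`**, from the OLD line data
(`hrow/hcol/hent` w.r.t. `F̃`, Gram `κg` w.r.t. `F̃`; every symbol supported in the plateau of `F`; overlap `ρ₀`, multiplicity `ρ₁` of `F̃`) and the
carrier's MIXED level norms w.r.t. the augmented thin family `F⁺ = pointAugment F e` (output legs prescribed to thin sectors OR to the points; contracted
legs summed). [cite: BenfattoGiulianiMastropietro2006, §2.8 (2.80)] -/
theorem klE5_tail_le_of_lineData_pointAugment {m₀ m₁ : ℕ} (hβ : 0 ≤ β) (F Ft : Fin N → FreqMomentum L M → ℂ)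
    {ρ₀ ρ₁ : ℕ} (hρ₀ : ∀ ω : Fin N, ((univ : Finset (Fin N)).filter fun ω' => ∃ q, Ft ω q * Ft ω' q ≠ 0).card ≤ ρ₀)
    (hρ₁ : ∀ k : FreqMomentum L M, ((univ : Finset (Fin N)).filter fun ω => Ft ω k ≠ 0).card ≤ ρ₁)
    (sym : ι → FreqMomentum L M × Fin 2 → ℂ) (s₀ s₁ : ι) (hsym : ∀ t ks, sym t ks ≠ 0 → ∑ ω, F ω ks.1 = 1)
    (hs₀ : normalCovariance L M (sym s₀) = klE5DressedSliceDeriv L M β μ K n₀ κ Λ)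
    (hs₁ : normalCovariance L M (sym s₁) = klE5Total L M β μ K n₀ κ - klE5DressedSlice L M β μ K n₀ κ Λ)
    (hĊ : ∀ X Y, klE5DressedSliceDeriv L M β μ K n₀ κ Λ X Y ≠ 0 → ∑ ω, F ω X.1.1 = 1 ∧ ∑ ω, F ω Y.1.1 = 1)
    (hD : ∀ X Y, (klE5Total L M β μ K n₀ κ - klE5DressedSlice L M β μ K n₀ κ Λ) X Y ≠ 0 → ∑ ω, F ω X.1.1 = 1 ∧ ∑ ω, F ω Y.1.1 = 1)
    (κg : ι → ℝ) (hκg : ∀ t, 0 ≤ κg t)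
    (hκF : ∀ (t : ι) (Y : SpaceTimeIdx L M × SectorLeg N), Y.2.2 = 0 → ‖sectorGramF L M β Ft (sym t) Y‖ ≤ κg t)
    (hκG : ∀ (t : ι) (Y : SpaceTimeIdx L M × SectorLeg N), Y.2.2 = 1 → ‖sectorGramG L M β Ft (sym t) Y‖ ≤ κg t)
    (s : Fin 4 → Fin 2) (hm₀ : (univ.filter fun i => s i = 0).card = m₀ + 1) (hm₁ : (univ.filter fun i => s i = 1).card = m₁)
    (Z : Fin 4 → SpaceTimeIdx L M × SectorLeg (N + 4)) {α : ℝ} (hα : 0 ≤ α)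
    (hrow : ∀ X, ∑ Y, ‖((sectorSubMatrix L M β Ft).transpose * normalCovariance L M (sym s₀) * sectorSubMatrix L M β Ft) X Y‖ ≤ α)
    (hcol : ∀ Y, ∑ X, ‖((sectorSubMatrix L M β Ft).transpose * normalCovariance L M (sym s₀) * sectorSubMatrix L M β Ft) X Y‖ ≤ α)
    {δ : ℝ} (hδ : 0 ≤ δ) (hent : ∀ X Y, ‖((sectorSubMatrix L M β Ft).transpose * normalCovariance L M (sym s₁) * sectorSubMatrix L M β Ft) X Y‖ ≤ δ)
    (Na Nb : ℕ → ℝ) (hNb0 : ∀ k, 0 ≤ Nb k)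
    (hNa : ∀ k ∈ Icc 3 (Fintype.card (HubbardFieldIdx L M × Fin 2) + 2), ∀ σ₀ : Fin (m₀ + 1) → SectorLeg (N + 4),
      hubbardSectorKernelNorm L M β (pointAugment F (klE5ExtMomenta Qm x y)) (prescribedTuples univ
        (Fin.append (fun _ : Fin k => (none : Option (SectorLeg (N + 4)))) (fun j => some (σ₀ j)))) (klE5Carrier L M β μ K n₀ κ V Λ) ≤ Na k)
    (hNb : ∀ k ∈ Icc 3 (Fintype.card (HubbardFieldIdx L M × Fin 2) + 2), ∀ (ω₀ : SectorLeg (N + 4)) (τ' : Fin 2 → SectorLeg (N + 4))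
      (ω₁ : Fin m₁ → SectorLeg (N + 4)),
      hubbardSectorKernelNorm L M β (pointAugment F (klE5ExtMomenta Qm x y)) (prescribedTuples univ
        (Fin.append (fun i : Fin k => if h : (i : ℕ) < 3 then some ((Fin.cons ω₀ τ' : Fin 3 → SectorLeg (N + 4)) ⟨i, h⟩) else none)
          (fun j => some (ω₁ j)))) (klE5Carrier L M β μ K n₀ κ V Λ) ≤ Nb k)
    {x' A : ℝ} (hx0 : 0 ≤ x') (hx1 : x' < 1) (hA : 0 ≤ A)
    (henv : ∀ k ∈ Icc 3 (Fintype.card (HubbardFieldIdx L M × Fin 2) + 2),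
      (∑ t, κg t ^ 2) ^ (k - 3) * ((imagTimeWeight β M * Na k) * (imagTimeWeight β M * Nb k)) ≤ x' ^ (k - 3) * A) :
    ∑ i ∈ Finset.Icc 2 (Fintype.card (HubbardFieldIdx L M × Fin 2) + 1), ((i.factorial : ℝ))⁻¹ *
        ‖kernel ℂ ((grassmannLaplacian ℂ (crossCov ℂ ((sectorSubMatrix L M β (pointAugmentFat F Ft (klE5ExtMomenta Qm x y))).transpose *
              (klE5Total L M β μ K n₀ κ - klE5DressedSlice L M β μ K n₀ κ Λ) * sectorSubMatrix L M β (pointAugmentFat F Ft (klE5ExtMomenta Qm x y)))) ^ i *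
            grassmannLaplacian ℂ (crossCov ℂ ((sectorSubMatrix L M β (pointAugmentFat F Ft (klE5ExtMomenta Qm x y))).transpose *
              klE5DressedSliceDeriv L M β μ K n₀ κ Λ * sectorSubMatrix L M β (pointAugmentFat F Ft (klE5ExtMomenta Qm x y)))))
          (dblCopy ℂ 0 (sectorPreimage β (pointAugment F (klE5ExtMomenta Qm x y)) (klE5Carrier L M β μ K n₀ κ V Λ)) *
            dblCopy ℂ 1 (sectorPreimage β (pointAugment F (klE5ExtMomenta Qm x y)) (klE5Carrier L M β μ K n₀ κ V Λ)))) 4 (fun j => (Z j, s j))‖ ≤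
      ((m₀ + m₁ + 5).factorial : ℝ) / ((4 : ℕ).factorial * (1 - x') ^ (m₀ + m₁ + 6)) * (α * (δ * ((4 * (ρ₀ + ρ₁ + 4) : ℕ) : ℝ)) ^ 2 * A) := by
  have hĊ' : ∀ X Y, normalCovariance L M (sym s₀) X Y ≠ 0 → ∑ ω, F ω X.1.1 = 1 ∧ ∑ ω, F ω Y.1.1 = 1 := by rw [hs₀]; exact hĊ
  have hD' : ∀ X Y, normalCovariance L M (sym s₁) X Y ≠ 0 → ∑ ω, F ω X.1.1 = 1 ∧ ∑ ω, F ω Y.1.1 = 1 := by rw [hs₁]; exact hD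
  exact klE5_tail_le_of_lineData β μ K n₀ κ V Λ hβ (pointAugment F (klE5ExtMomenta Qm x y)) (pointAugmentFat F Ft (klE5ExtMomenta Qm x y))
    (card_filter_overlap_pointAugmentFat_le F Ft _ hρ₀ hρ₁) sym s₀ s₁ hs₀ hs₁ κg
    (fun t Y hY => norm_sectorGramF_pointAugmentFat_le β F Ft _ (sym t) (hsym t) (hκg t) (hκF t) Y hY)
    (fun t Y hY => norm_sectorGramG_pointAugmentFat_le β F Ft _ (sym t) (hsym t) (hκg t) (hκG t) Y hY)
    s hm₀ hm₁ Z hα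
    (rowSum_pullback_pointAugmentFat_le β F Ft _ _ hĊ' hα hrow) (colSum_pullback_pointAugmentFat_le β F Ft _ _ hĊ' hα hcol)
    hδ (entry_pullback_pointAugmentFat_le β F Ft _ _ hD' hδ hent) Na Nb hNb0 hNa hNb hx0 hx1 hA henv

/-- **The same at a colouring with `m₁ + 1 ≥ 1` legs from copy `1`** (roles exchanged). [cite: BenfattoGiulianiMastropietro2006, §2.8 (2.80)] -/
theorem klE5_tail_le_of_lineData_pointAugment_of_b {m₀ m₁ : ℕ} (hβ : 0 ≤ β) (F Ft : Fin N → FreqMomentum L M → ℂ)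
    {ρ₀ ρ₁ : ℕ} (hρ₀ : ∀ ω : Fin N, ((univ : Finset (Fin N)).filter fun ω' => ∃ q, Ft ω q * Ft ω' q ≠ 0).card ≤ ρ₀)
    (hρ₁ : ∀ k : FreqMomentum L M, ((univ : Finset (Fin N)).filter fun ω => Ft ω k ≠ 0).card ≤ ρ₁)
    (sym : ι → FreqMomentum L M × Fin 2 → ℂ) (s₀ s₁ : ι) (hsym : ∀ t ks, sym t ks ≠ 0 → ∑ ω, F ω ks.1 = 1)
    (hs₀ : normalCovariance L M (sym s₀) = klE5DressedSliceDeriv L M β μ K n₀ κ Λ)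
    (hs₁ : normalCovariance L M (sym s₁) = klE5Total L M β μ K n₀ κ - klE5DressedSlice L M β μ K n₀ κ Λ)
    (hĊ : ∀ X Y, klE5DressedSliceDeriv L M β μ K n₀ κ Λ X Y ≠ 0 → ∑ ω, F ω X.1.1 = 1 ∧ ∑ ω, F ω Y.1.1 = 1)
    (hD : ∀ X Y, (klE5Total L M β μ K n₀ κ - klE5DressedSlice L M β μ K n₀ κ Λ) X Y ≠ 0 → ∑ ω, F ω X.1.1 = 1 ∧ ∑ ω, F ω Y.1.1 = 1)
    (κg : ι → ℝ) (hκg : ∀ t, 0 ≤ κg t)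
    (hκF : ∀ (t : ι) (Y : SpaceTimeIdx L M × SectorLeg N), Y.2.2 = 0 → ‖sectorGramF L M β Ft (sym t) Y‖ ≤ κg t)
    (hκG : ∀ (t : ι) (Y : SpaceTimeIdx L M × SectorLeg N), Y.2.2 = 1 → ‖sectorGramG L M β Ft (sym t) Y‖ ≤ κg t)
    (s : Fin 4 → Fin 2) (hm₀ : (univ.filter fun i => s i = 0).card = m₀) (hm₁ : (univ.filter fun i => s i = 1).card = m₁ + 1)
    (Z : Fin 4 → SpaceTimeIdx L M × SectorLeg (N + 4)) {α : ℝ} (hα : 0 ≤ α)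
    (hrow : ∀ X, ∑ Y, ‖((sectorSubMatrix L M β Ft).transpose * normalCovariance L M (sym s₀) * sectorSubMatrix L M β Ft) X Y‖ ≤ α)
    (hcol : ∀ Y, ∑ X, ‖((sectorSubMatrix L M β Ft).transpose * normalCovariance L M (sym s₀) * sectorSubMatrix L M β Ft) X Y‖ ≤ α)
    {δ : ℝ} (hδ : 0 ≤ δ) (hent : ∀ X Y, ‖((sectorSubMatrix L M β Ft).transpose * normalCovariance L M (sym s₁) * sectorSubMatrix L M β Ft) X Y‖ ≤ δ)
    (Na Nb : ℕ → ℝ) (hNa0 : ∀ k, 0 ≤ Na k)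
    (hNa : ∀ k ∈ Icc 3 (Fintype.card (HubbardFieldIdx L M × Fin 2) + 2), ∀ (ω₀ : SectorLeg (N + 4)) (σ' : Fin 2 → SectorLeg (N + 4))
      (ω₁ : Fin m₀ → SectorLeg (N + 4)),
      hubbardSectorKernelNorm L M β (pointAugment F (klE5ExtMomenta Qm x y)) (prescribedTuples univ
        (Fin.append (fun i : Fin k => if h : (i : ℕ) < 3 then some ((Fin.cons ω₀ σ' : Fin 3 → SectorLeg (N + 4)) ⟨i, h⟩) else none)
          (fun j => some (ω₁ j)))) (klE5Carrier L M β μ K n₀ κ V Λ) ≤ Na k)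
    (hNb : ∀ k ∈ Icc 3 (Fintype.card (HubbardFieldIdx L M × Fin 2) + 2), ∀ σ₁ : Fin (m₁ + 1) → SectorLeg (N + 4),
      hubbardSectorKernelNorm L M β (pointAugment F (klE5ExtMomenta Qm x y)) (prescribedTuples univ
        (Fin.append (fun _ : Fin k => (none : Option (SectorLeg (N + 4)))) (fun j => some (σ₁ j)))) (klE5Carrier L M β μ K n₀ κ V Λ) ≤ Nb k)
    {x' A : ℝ} (hx0 : 0 ≤ x') (hx1 : x' < 1) (hA : 0 ≤ A)
    (henv : ∀ k ∈ Icc 3 (Fintype.card (HubbardFieldIdx L M × Fin 2) + 2),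
      (∑ t, κg t ^ 2) ^ (k - 3) * ((imagTimeWeight β M * Na k) * (imagTimeWeight β M * Nb k)) ≤ x' ^ (k - 3) * A) :
    ∑ i ∈ Finset.Icc 2 (Fintype.card (HubbardFieldIdx L M × Fin 2) + 1), ((i.factorial : ℝ))⁻¹ *
        ‖kernel ℂ ((grassmannLaplacian ℂ (crossCov ℂ ((sectorSubMatrix L M β (pointAugmentFat F Ft (klE5ExtMomenta Qm x y))).transpose *
              (klE5Total L M β μ K n₀ κ - klE5DressedSlice L M β μ K n₀ κ Λ) * sectorSubMatrix L M β (pointAugmentFat F Ft (klE5ExtMomenta Qm x y)))) ^ i *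
            grassmannLaplacian ℂ (crossCov ℂ ((sectorSubMatrix L M β (pointAugmentFat F Ft (klE5ExtMomenta Qm x y))).transpose *
              klE5DressedSliceDeriv L M β μ K n₀ κ Λ * sectorSubMatrix L M β (pointAugmentFat F Ft (klE5ExtMomenta Qm x y)))))
          (dblCopy ℂ 0 (sectorPreimage β (pointAugment F (klE5ExtMomenta Qm x y)) (klE5Carrier L M β μ K n₀ κ V Λ)) *
            dblCopy ℂ 1 (sectorPreimage β (pointAugment F (klE5ExtMomenta Qm x y)) (klE5Carrier L M β μ K n₀ κ V Λ)))) 4 (fun j => (Z j, s j))‖ ≤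
      ((m₀ + m₁ + 5).factorial : ℝ) / ((4 : ℕ).factorial * (1 - x') ^ (m₀ + m₁ + 6)) * (α * (δ * ((4 * (ρ₀ + ρ₁ + 4) : ℕ) : ℝ)) ^ 2 * A) := by
  have hĊ' : ∀ X Y, normalCovariance L M (sym s₀) X Y ≠ 0 → ∑ ω, F ω X.1.1 = 1 ∧ ∑ ω, F ω Y.1.1 = 1 := by rw [hs₀]; exact hĊ
  have hD' : ∀ X Y, normalCovariance L M (sym s₁) X Y ≠ 0 → ∑ ω, F ω X.1.1 = 1 ∧ ∑ ω, F ω Y.1.1 = 1 := by rw [hs₁]; exact hD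
  exact klE5_tail_le_of_lineData_of_b β μ K n₀ κ V Λ hβ (pointAugment F (klE5ExtMomenta Qm x y)) (pointAugmentFat F Ft (klE5ExtMomenta Qm x y))
    (card_filter_overlap_pointAugmentFat_le F Ft _ hρ₀ hρ₁) sym s₀ s₁ hs₀ hs₁ κg
    (fun t Y hY => norm_sectorGramF_pointAugmentFat_le β F Ft _ (sym t) (hsym t) (hκg t) (hκF t) Y hY)
    (fun t Y hY => norm_sectorGramG_pointAugmentFat_le β F Ft _ (sym t) (hsym t) (hκg t) (hκG t) Y hY)
    s hm₀ hm₁ Z hα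
    (rowSum_pullback_pointAugmentFat_le β F Ft _ _ hĊ' hα hrow) (colSum_pullback_pointAugmentFat_le β F Ft _ _ hĊ' hα hcol)
    hδ (entry_pullback_pointAugmentFat_le β F Ft _ _ hD' hδ hent) Na Nb hNa0 hNa hNb hx0 hx1 hA henv

end Tails

/-! ## §3 The plateau hypotheses for the thin family `klAnisoFamily … klE0 m`, `m + 1 ≤ n₀` (line supports from the cutoff geometry) -/

section Plateau

variable {L M : ℕ} (β μ : ℝ) (K : TrigPolyC4v) (n₀ : ℕ) (κ : FreqMomentum L M × Fin 2 → ℂ)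

/-- **Support of the line-`0` symbol**: `klE5DerivLineSym … Λ ks ≠ 0 ⇒ ω² + e_K² ≤ Λ²` (the derivative weight lives on the shell `Λ²/4 ≤ t² ≤ Λ²`,
`klws_deriv_cutoffWeight_scale_eq_zero`). -/
theorem sq_le_sq_of_klE5DerivLineSym_ne_zero {Λ : ℝ} (hΛ : Λ ≠ 0) (ks : FreqMomentum L M × Fin 2) (h : klE5DerivLineSym L M β μ K n₀ κ Λ ks ≠ 0) :
    matsubaraFreq β M ks.1.1 ^ 2 + nambuXiCT L μ K ks.1.2 ^ 2 ≤ Λ ^ 2 := by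
  by_contra hlt
  exact deriv_cutoffWeight_ne_zero_of_klE5DerivLineSym_ne_zero L M β μ K n₀ κ Λ ks h
    (klws_deriv_cutoffWeight_scale_eq_zero L M β μ K hΛ ks.1 (Or.inr (not_le.1 hlt)))

/-- **Support of the soft-line symbol**: for `0 < Λ ≤ Λ_{n₀}`, `klE5SoftLineSym … Λ ks ≠ 0 ⇒ ω² + e_K² < Λ_{n₀}²` (above `Λ_{n₀}` all three weights are `1`,
`klE5SoftLineSym_eq_zero_of`). -/
theorem sq_lt_sq_of_klE5SoftLineSym_ne_zero {Λ : ℝ} (hΛ0 : 0 < Λ) (hΛ : Λ ≤ klScale klE0 n₀) (ks : FreqMomentum L M × Fin 2)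
    (h : klE5SoftLineSym L M β μ K n₀ κ Λ ks ≠ 0) : matsubaraFreq β M ks.1.1 ^ 2 + nambuXiCT L μ K ks.1.2 ^ 2 < klScale klE0 n₀ ^ 2 := by
  by_contra hge
  have hge' := not_lt.1 hge
  have h0 := hubbardCutoffWeightCT_eq_one_of_sq_le (L := L) β μ K (klth_klScale_pos n₀) ks.1 hge'
  have h01 : klScale klE0 (n₀ + 1) ^ 2 ≤ klScale klE0 n₀ ^ 2 :=
    pow_le_pow_left₀ (klth_klScale_pos _).le (klScale_le_klScale (by norm_num [klE0]) (Nat.le_succ n₀)) 2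
  have h1 := hubbardCutoffWeightCT_eq_one_of_sq_le (L := L) β μ K (klth_klScale_pos (n₀ + 1)) ks.1 (h01.trans hge')
  have hΛ' := hubbardCutoffWeightCT_eq_one_of_sq_le (L := L) β μ K hΛ0 ks.1 ((pow_le_pow_left₀ hΛ0.le hΛ 2).trans hge')
  exact h (klE5SoftLineSym_eq_zero_of L M β μ K n₀ κ Λ ks h1 (h1.trans h0.symm) (hΛ'.trans h0.symm))

/-- **Line `0` lies in the plateau of `klAnisoFamily … klE0 m`** for `m + 1 ≤ n₀` and `0 < Λ ≤ Λ_{n₀}`. -/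
theorem sum_klAnisoFamily_eq_one_of_klE5DerivLineSym_ne_zero {m : ℕ} (hm : m + 1 ≤ n₀) {Λ : ℝ} (hΛ0 : 0 < Λ) (hΛ : Λ ≤ klScale klE0 n₀)
    (ks : FreqMomentum L M × Fin 2) (h : klE5DerivLineSym L M β μ K n₀ κ Λ ks ≠ 0) : ∑ ω, klAnisoFamily L M β μ K klE0 m ω ks.1 = 1 := by
  refine sum_klAnisoFamily_eq_one_of_le β μ K (by norm_num [klE0]) m ks.1 ?_
  have ht := sq_le_sq_of_klE5DerivLineSym_ne_zero β μ K n₀ κ hΛ0.ne' ks h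
  have hΛm : Λ ≤ klScale klE0 (m + 1) := hΛ.trans (klScale_le_klScale (by norm_num [klE0]) hm)
  calc Real.sqrt (matsubaraFreq β M ks.1.1 ^ 2 + nambuXiCT L μ K ks.1.2 ^ 2) ≤ Real.sqrt (Λ ^ 2) := Real.sqrt_le_sqrt ht
    _ = Λ := Real.sqrt_sq hΛ0.le
    _ ≤ klScale klE0 (m + 1) := hΛm

/-- **The soft lines lie in the plateau of `klAnisoFamily … klE0 m`** for `m + 1 ≤ n₀` and `0 < Λ ≤ Λ_{n₀}`. -/
theorem sum_klAnisoFamily_eq_one_of_klE5SoftLineSym_ne_zero {m : ℕ} (hm : m + 1 ≤ n₀) {Λ : ℝ} (hΛ0 : 0 < Λ) (hΛ : Λ ≤ klScale klE0 n₀)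
    (ks : FreqMomentum L M × Fin 2) (h : klE5SoftLineSym L M β μ K n₀ κ Λ ks ≠ 0) : ∑ ω, klAnisoFamily L M β μ K klE0 m ω ks.1 = 1 := by
  refine sum_klAnisoFamily_eq_one_of_le β μ K (by norm_num [klE0]) m ks.1 ?_
  have ht := sq_lt_sq_of_klE5SoftLineSym_ne_zero β μ K n₀ κ hΛ0 hΛ ks h
  have hm' : klScale klE0 n₀ ≤ klScale klE0 (m + 1) := klScale_le_klScale (by norm_num [klE0]) hm
  calc Real.sqrt (matsubaraFreq β M ks.1.1 ^ 2 + nambuXiCT L μ K ks.1.2 ^ 2) ≤ Real.sqrt (klScale klE0 n₀ ^ 2) := Real.sqrt_le_sqrt ht.le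
    _ = klScale klE0 n₀ := Real.sqrt_sq (klth_klScale_pos n₀).le
    _ ≤ klScale klE0 (m + 1) := hm'

/-- **Hypothesis `hĊ` of `norm_klE5Block_le_of_tails(_pointAugment)` for `F = klAnisoFamily … klE0 m`**, `m + 1 ≤ n₀`, `0 < Λ ≤ Λ_{n₀}`. -/
theorem klE5DressedSliceDeriv_plateau_klAnisoFamily {m : ℕ} (hm : m + 1 ≤ n₀) {Λ : ℝ} (hΛ0 : 0 < Λ) (hΛ : Λ ≤ klScale klE0 n₀)
    (X Y : HubbardFieldIdx L M) (h : klE5DressedSliceDeriv L M β μ K n₀ κ Λ X Y ≠ 0) :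
    ∑ ω, klAnisoFamily L M β μ K klE0 m ω X.1.1 = 1 ∧ ∑ ω, klAnisoFamily L M β μ K klE0 m ω Y.1.1 = 1 :=
  klE5DressedSliceDeriv_plateau L M β μ K n₀ κ Λ (fun k => ∑ ω, klAnisoFamily L M β μ K klE0 m ω k)
    (sum_klAnisoFamily_eq_one_of_klE5DerivLineSym_ne_zero β μ K n₀ κ hm hΛ0 hΛ) X Y h

/-- **Hypothesis `hD` of `norm_klE5Block_le_of_tails(_pointAugment)` for `F = klAnisoFamily … klE0 m`**, `m + 1 ≤ n₀`, `0 < Λ ≤ Λ_{n₀}`. -/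
theorem klE5Total_sub_dressedSlice_plateau_klAnisoFamily [NeZero L] {m : ℕ} (hm : m + 1 ≤ n₀) {Λ : ℝ} (hΛ0 : 0 < Λ) (hΛ : Λ ≤ klScale klE0 n₀)
    (X Y : HubbardFieldIdx L M) (h : (klE5Total L M β μ K n₀ κ - klE5DressedSlice L M β μ K n₀ κ Λ) X Y ≠ 0) :
    ∑ ω, klAnisoFamily L M β μ K klE0 m ω X.1.1 = 1 ∧ ∑ ω, klAnisoFamily L M β μ K klE0 m ω Y.1.1 = 1 :=
  klE5Total_sub_dressedSlice_plateau L M β μ K n₀ κ Λ (fun k => ∑ ω, klAnisoFamily L M β μ K klE0 m ω k)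
    (sum_klAnisoFamily_eq_one_of_klE5SoftLineSym_ne_zero β μ K n₀ κ hm hΛ0 hΛ) X Y h

/-- **Hypothesis `hsym` of `klE5_tail_le_of_lineData_pointAugment` for the two-symbol family `![klE5DerivLineSym, klE5SoftLineSym]`** and
`F = klAnisoFamily … klE0 m`, `m + 1 ≤ n₀`, `0 < Λ ≤ Λ_{n₀}`. -/
theorem klE5_sym_plateau_klAnisoFamily {m : ℕ} (hm : m + 1 ≤ n₀) {Λ : ℝ} (hΛ0 : 0 < Λ) (hΛ : Λ ≤ klScale klE0 n₀)
    (t : Fin 2) (ks : FreqMomentum L M × Fin 2)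
    (h : (![klE5DerivLineSym L M β μ K n₀ κ Λ, klE5SoftLineSym L M β μ K n₀ κ Λ] : Fin 2 → FreqMomentum L M × Fin 2 → ℂ) t ks ≠ 0) :
    ∑ ω, klAnisoFamily L M β μ K klE0 m ω ks.1 = 1 := by
  fin_cases t
  · exact sum_klAnisoFamily_eq_one_of_klE5DerivLineSym_ne_zero β μ K n₀ κ hm hΛ0 hΛ ks h
  · exact sum_klAnisoFamily_eq_one_of_klE5SoftLineSym_ne_zero β μ K n₀ κ hm hΛ0 hΛ ks h

end Plateau

/-! ## §4 Sup sizes of the two line symbols under the dressing smallness `‖s·κ‖ ≤ ½` (for the L1/L2 suppliers' sup-type data) -/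

section Sizes

variable {L M : ℕ} (β μ : ℝ) (K : TrigPolyC4v) (n₀ : ℕ) (κ : FreqMomentum L M × Fin 2 → ℂ)

/-- **Size of the line-`0` symbol**: `‖klE5DerivLineSym … Λ ks‖ ≤ 4·‖ṡ_Λ(ks)‖` when `‖s_Λ(ks)κ(ks)‖ ≤ ½` (with `‖ṡ_Λ‖ ≤ (64/3)/|Λ|·|βL²G^K|` from
`klws_abs_deriv_cutoffWeight_scale_le`). -/
theorem norm_klE5DerivLineSym_le {Λ : ℝ} (ks : FreqMomentum L M × Fin 2) (h : ‖klE5SliceSym L M β μ K n₀ Λ ks * κ ks‖ ≤ 1 / 2) :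
    ‖klE5DerivLineSym L M β μ K n₀ κ Λ ks‖ ≤ 4 * ‖klE5SliceSymDeriv L M β μ K Λ ks‖ := by
  unfold klE5DerivLineSym
  rw [norm_div, norm_pow, div_eq_mul_inv, ← inv_pow]
  -- `‖(1+z)⁻¹‖ ≤ 2` for `‖z‖ ≤ ½` (as `Literature.…Loewner.norm_inv_one_add_le`, inlined to keep the import closure inside the Hubbard chain)
  have hm : ‖1 + klE5SliceSym L M β μ K n₀ Λ ks * κ ks‖⁻¹ ≤ 2 := by
    have h1 : 1 / 2 ≤ ‖1 + klE5SliceSym L M β μ K n₀ Λ ks * κ ks‖ := by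
      have h0 := norm_sub_le (1 + klE5SliceSym L M β μ K n₀ Λ ks * κ ks) (klE5SliceSym L M β μ K n₀ Λ ks * κ ks)
      rw [add_sub_cancel_right, norm_one] at h0; linarith
    exact (inv_le_comm₀ (lt_of_lt_of_le (by norm_num) h1) two_pos).mpr (by linarith)
  have h0 : 0 ≤ ‖1 + klE5SliceSym L M β μ K n₀ Λ ks * κ ks‖⁻¹ := inv_nonneg.2 (norm_nonneg _)
  calc ‖klE5SliceSymDeriv L M β μ K Λ ks‖ * ‖1 + klE5SliceSym L M β μ K n₀ Λ ks * κ ks‖⁻¹ ^ 2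
      ≤ ‖klE5SliceSymDeriv L M β μ K Λ ks‖ * 2 ^ 2 := by gcongr
    _ = 4 * ‖klE5SliceSymDeriv L M β μ K Λ ks‖ := by ring

/-- **Size of the soft-line symbol**: with `m̂ = (1 + s_{Λ_{n₀+1}}κ)⁻¹` and both dressing products `≤ ½` in norm,
`‖klE5SoftLineSym … Λ ks‖ ≤ 4·‖(1 − w_{Λ_{n₀+1}})·βL²G^K‖ + 2·‖s_{Λ_{n₀+1}}‖ + 2·‖s_Λ‖` — so sup-type line data (`norm_sectorGramF/G_le_of_count`,
entry counts) for the DRESSED soft line follow from those of the bare soft and partial-slice symbols. -/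
theorem norm_klE5SoftLineSym_le {Λ : ℝ} (ks : FreqMomentum L M × Fin 2)
    (h1 : ‖klE5SliceSym L M β μ K n₀ (klScale klE0 (n₀ + 1)) ks * κ ks‖ ≤ 1 / 2) (hΛ : ‖klE5SliceSym L M β μ K n₀ Λ ks * κ ks‖ ≤ 1 / 2) :
    ‖klE5SoftLineSym L M β μ K n₀ κ Λ ks‖ ≤
      4 * ‖(1 - (hubbardCutoffWeightCT L M β μ K (klScale klE0 (n₀ + 1)) ks.1 : ℂ)) *
          (((β * (L : ℝ) ^ 2 : ℝ) : ℂ) * ((Complex.I * matsubaraFreq β M ks.1.1 + nambuXiCT L μ K ks.1.2) / nambuDenCT L M β μ 0 K ks.1))‖ +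
        2 * ‖klE5SliceSym L M β μ K n₀ (klScale klE0 (n₀ + 1)) ks‖ + 2 * ‖klE5SliceSym L M β μ K n₀ Λ ks‖ := by
  have hinv : ∀ {z : ℂ}, ‖z‖ ≤ 1 / 2 → ‖(1 + z)⁻¹‖ ≤ 2 := fun {z} hz => by
    have h1 : 1 / 2 ≤ ‖1 + z‖ := by
      have h0 := norm_sub_le (1 + z) z; rw [add_sub_cancel_right, norm_one] at h0; linarith
    rw [norm_inv]; exact (inv_le_comm₀ (lt_of_lt_of_le (by norm_num) h1) two_pos).mpr (by linarith)
  have hm1 := hinv h1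
  have hmΛ := hinv hΛ
  set A := (1 - (hubbardCutoffWeightCT L M β μ K (klScale klE0 (n₀ + 1)) ks.1 : ℂ)) *
    (((β * (L : ℝ) ^ 2 : ℝ) : ℂ) * ((Complex.I * matsubaraFreq β M ks.1.1 + nambuXiCT L μ K ks.1.2) / nambuDenCT L M β μ 0 K ks.1)) with hA
  set s₁ := klE5SliceSym L M β μ K n₀ (klScale klE0 (n₀ + 1)) ks with hs₁
  set sΛ := klE5SliceSym L M β μ K n₀ Λ ks with hsΛ
  have hX : ‖(1 + s₁ * κ ks)⁻¹ ^ 2 * A‖ ≤ 4 * ‖A‖ := by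
    rw [norm_mul, norm_pow]
    calc ‖(1 + s₁ * κ ks)⁻¹‖ ^ 2 * ‖A‖ ≤ 2 ^ 2 * ‖A‖ := by gcongr
      _ = 4 * ‖A‖ := by ring
  have hY : ‖s₁ / (1 + s₁ * κ ks)‖ ≤ 2 * ‖s₁‖ := by
    rw [norm_div, div_eq_mul_inv, ← norm_inv]
    calc ‖s₁‖ * ‖(1 + s₁ * κ ks)⁻¹‖ ≤ ‖s₁‖ * 2 := by gcongr
      _ = 2 * ‖s₁‖ := by ring
  have hZ : ‖sΛ / (1 + sΛ * κ ks)‖ ≤ 2 * ‖sΛ‖ := by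
    rw [norm_div, div_eq_mul_inv, ← norm_inv]
    calc ‖sΛ‖ * ‖(1 + sΛ * κ ks)⁻¹‖ ≤ ‖sΛ‖ * 2 := by gcongr
      _ = 2 * ‖sΛ‖ := by ring
  unfold klE5SoftLineSym
  rw [← hA, ← hs₁, ← hsΛ]
  calc ‖(1 + s₁ * κ ks)⁻¹ ^ 2 * A + (s₁ / (1 + s₁ * κ ks) - sΛ / (1 + sΛ * κ ks))‖
      ≤ ‖(1 + s₁ * κ ks)⁻¹ ^ 2 * A‖ + (‖s₁ / (1 + s₁ * κ ks)‖ + ‖sΛ / (1 + sΛ * κ ks)‖) :=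
        (norm_add_le _ _).trans (add_le_add_right (norm_sub_le _ _) _)
    _ ≤ 4 * ‖A‖ + (2 * ‖s₁‖ + 2 * ‖sΛ‖) := add_le_add hX (add_le_add hY hZ)
    _ = 4 * ‖A‖ + 2 * ‖s₁‖ + 2 * ‖sΛ‖ := by ring

end Sizes

/-! ## §5 The instance of record: `F = klAnisoFamily … K klE0 (m+1)`, `F̃ = bgmFatMultiplier … (m+1)`, `m + 2 ≤ n₀` — all family-side hypotheses discharged -/

section KlAniso

variable {L M : ℕ} [NeZero L] [NeZero M] (β μ : ℝ) (K : TrigPolyC4v) (n₀ : ℕ) (κ : FreqMomentum L M × Fin 2 → ℂ)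
  (V : HubbardGrassmann L M) (Λ : ℝ) (Qm : TorusSite 2 L) (x y : TorusSite 2 L × MatsubaraIdx M)

omit [NeZero M] in
/-- Multiplicity from overlap: if every multiplier overlaps at most `ρ₀` others, at most `ρ₀` multipliers meet any momentum. [folklore] -/
theorem card_filter_ne_zero_le_of_overlap {N ρ₀ : ℕ} (Ft : Fin N → FreqMomentum L M → ℂ)
    (hρ₀ : ∀ ω : Fin N, ((univ : Finset (Fin N)).filter fun ω' => ∃ q, Ft ω q * Ft ω' q ≠ 0).card ≤ ρ₀) (k : FreqMomentum L M) :
    ((univ : Finset (Fin N)).filter fun ω => Ft ω k ≠ 0).card ≤ ρ₀ := by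
  classical
  by_cases h : ∃ ω₀, Ft ω₀ k ≠ 0
  · obtain ⟨ω₀, h0⟩ := h
    refine (card_le_card fun ω hω => mem_filter.2 ⟨mem_univ _, ⟨k, mul_ne_zero h0 (mem_filter.1 hω).2⟩⟩).trans (hρ₀ ω₀)
  · rw [filter_false_of_mem fun ω _ => fun hω => h ⟨ω, hω⟩, card_empty]
    exact Nat.zero_le _

/-- **The E.5 block at ANY labels for the thin/fat pair of record** (`klAnisoFamily … K klE0 (m+1)` / `bgmFatMultiplier … (m+1)`, `m + 2 ≤ n₀`,
`0 < Λ ≤ Λ_{n₀}`): every family-side hypothesis of `norm_klE5Block_le_of_tails_pointAugment` is discharged (`F̃F = F`, `ΣF = 0 ⇒ F = 0`, the plateaux of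
the two lines from §3, row sums `R₁ = ((βL²)⁻¹·|SpaceTimeIdx|)·13` from `‖F̃‖ ≤ 1` and overlap `9`); what remains is the colouring-wise tail hypothesis
`hT` (from `klE5_tail_le_of_lineData_pointAugment(_of_b)` with `ρ₀ = ρ₁ = 9`). [cite: BenfattoGiulianiMastropietro2006, §2.7 (2.70)] -/
theorem norm_klE5Block_le_of_tails_klAniso (hβ : β ≠ 0) {m : ℕ} (hm : m + 2 ≤ n₀) (hΛ0 : 0 < Λ) (hΛ : Λ ≤ klScale klE0 n₀)
    (T : (Fin 4 → Fin 2) → ℝ) (hT0 : ∀ s, 0 ≤ T s)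
    (hT : ∀ (s : Fin 4 → Fin 2) (Z : Fin 4 → SpaceTimeIdx L M × SectorLeg (sectorCount (m + 1) + 4)),
      ∑ i ∈ Finset.Icc 2 (Fintype.card (HubbardFieldIdx L M × Fin 2) + 1), ((i.factorial : ℝ))⁻¹ *
        ‖kernel ℂ ((grassmannLaplacian ℂ (crossCov ℂ
              ((sectorSubMatrix L M β (pointAugmentFat (klAnisoFamily L M β μ K klE0 (m + 1))
                  (bgmFatMultiplier L M klE0 β (nambuXiCT L μ K) (m + 1)) (klE5ExtMomenta Qm x y))).transpose *
                (klE5Total L M β μ K n₀ κ - klE5DressedSlice L M β μ K n₀ κ Λ) *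
                sectorSubMatrix L M β (pointAugmentFat (klAnisoFamily L M β μ K klE0 (m + 1))
                  (bgmFatMultiplier L M klE0 β (nambuXiCT L μ K) (m + 1)) (klE5ExtMomenta Qm x y)))) ^ i *
            grassmannLaplacian ℂ (crossCov ℂ
              ((sectorSubMatrix L M β (pointAugmentFat (klAnisoFamily L M β μ K klE0 (m + 1))
                  (bgmFatMultiplier L M klE0 β (nambuXiCT L μ K) (m + 1)) (klE5ExtMomenta Qm x y))).transpose *
                klE5DressedSliceDeriv L M β μ K n₀ κ Λ *
                sectorSubMatrix L M β (pointAugmentFat (klAnisoFamily L M β μ K klE0 (m + 1))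
                  (bgmFatMultiplier L M klE0 β (nambuXiCT L μ K) (m + 1)) (klE5ExtMomenta Qm x y)))))
          (dblCopy ℂ 0 (sectorPreimage β (pointAugment (klAnisoFamily L M β μ K klE0 (m + 1)) (klE5ExtMomenta Qm x y))
              (klE5Carrier L M β μ K n₀ κ V Λ)) *
            dblCopy ℂ 1 (sectorPreimage β (pointAugment (klAnisoFamily L M β μ K klE0 (m + 1)) (klE5ExtMomenta Qm x y))
              (klE5Carrier L M β μ K n₀ κ V Λ)))) 4 (fun j => (Z j, s j))‖ ≤ T s) :
    ‖klE5Block L M β μ K n₀ κ V Λ Qm x y‖ ≤ ((4 : ℕ).factorial : ℝ) * |β * (L : ℝ) ^ 2| ^ 3 *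
      (((‖((1 / (β * (L : ℝ) ^ 2) : ℝ) : ℂ)‖ * Fintype.card (SpaceTimeIdx L M)) * ((9 + 4 : ℕ) : ℝ)) ^ 4 * ∑ s : Fin 4 → Fin 2, T s) := by
  have hm' : (m + 1) + 1 ≤ n₀ := by omega
  have hρ₀ := card_overlap_bgmFat_le_nine (L := L) (M := M) (e₀ := klE0) (β := β) (μ := μ) (K := K) m
  refine norm_klE5Block_le_of_tails_pointAugment β μ K n₀ κ V Λ Qm x y hβ (klAnisoFamily L M β μ K klE0 (m + 1))
    (bgmFatMultiplier L M klE0 β (nambuXiCT L μ K) (m + 1)) (fun ω k => ?_) (klAnisoFamily_eq_zero_of_sum_eq_zero β μ K klE0 (m + 1))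
    (klE5DressedSliceDeriv_plateau_klAnisoFamily β μ K n₀ κ hm' hΛ0 hΛ) (klE5Total_sub_dressedSlice_plateau_klAnisoFamily β μ K n₀ κ hm' hΛ0 hΛ)
    (sum_norm_sectorSubMatrix_pointAugmentFat_le β Qm x y _ _ (norm_bgmFatMultiplier_le_one klE0 β (nambuXiCT L μ K) (m + 1))
      (card_filter_ne_zero_le_of_overlap _ fun ω => by convert hρ₀ ω)) T hT0 hT
  unfold klAnisoFamily
  exact bgmFatMultiplier_mul_bgmMultiplier (by norm_num [klE0]) β (nambuXiCT L μ K) (m + 1) ω k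

end KlAniso

end Summit.HubbardSuperconductivity.HubbardSuperconductivity.Theorems.KLRegimeSplit

end
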